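import Summits.QuantumFields.YangMills.Theorems.BalabanUVNodesN15KingModelCombesThomasPropagator
import Summits.QuantumFields.YangMills.Theorems.BalabanUVNodesN15KingModelCovariantBlockSmallCurvature
import Summits.QuantumFields.YangMills.Theorems.BalabanUVNodesN15KingModelCovariantBlockPureGauge
import Summits.QuantumFields.YangMills.Theorems.BalabanUVNodesN15KingModelCovariantBlockPositivity
import HarnessLib

/-!
# BalabanUVNodes ∕ N15 — THE KING-MODEL RUNG (PART Ϧ-d): THE FOUR CLASSES OF LINK FIELDS AT WHICH KING's ∕ BAŁABAN's FULL BACKGROUND PROPAGATOR DECAYS — (i) SMALL CURVATURE (the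
# (3.35)-type class `‖P_U − 1‖ ≤ ε₀∕L²`, [B9] Theorem 3.1's hypothesis): `η`-UNIFORM exponential decay with constants depending on `m², a, d, ε₀` ONLY; (ii) PURE GAUGES (flat fields): EXACTLY
# the tree's `U ≡ 1` constants `(2∕γ_A, κ_A)` of [Dimock2013] Lemma 30, at every pure gauge and fibre; (iii) EVERY unitary link field (tree gauge, no regularity): decay with an `L`-dependent but
# VOLUME-free rate — the block term localises the massless covariant propagator everywhere; (iv) SMALL-FIELD GAUGES ((3.37)-type)
# (Track A, DAG node N15 = NE2; FAN-OUT v1.1 §N15 s3 «KING-MODEL RUNG … + what the curved case adds»; count-neutral)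

EDITION v1.1 (DOC-ONLY, ERRATUM-Ϧ1, 2026-08-31): locators corrected after ref-J READ-769∕770 — [Balaban1985BackgroundPropagators] (3.37) is on p.396 (not p.397) and (3.48)–(3.50) span pp.398–400 (not p.398),
verified first-hand on the held text (journal page = 388 + file page).  Declarations byte-identical to v1.0.

HONEST FRAMING.  Count-neutral (cell `pub-ymgap`, seat `pub-ymgap-dag-n15-e` g50; `--supports stmt-QuantumFields-27247 --as helper` = K3ᴬ, KEY MAP v3).  King's ONE-LEVEL comparison model on
one finite torus per spacing, King's scaling `A₀(U) = L²(−Δ_U) + m² + aQ(U)^*Q(U)` (`η = L⁻¹`), Bałaban's one-level covariant block mean along the COMB (class (i), (iv)) or any tree contour system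
((ii), (iii)); `ℓ²`-Combes–Thomas prefactors `2∕κ` (not the short-distance `L^∞` content of (3.46)∕King's Props 3.8–3.9); the small-curvature constants are the crude ones of PART Ϥ-o.  What is
DECIDED here is the SHAPE of [Balaban1985BackgroundPropagators] Theorem 3.1 ∕ (3.39) for the one-level `G(U)` of King's model: exponential decay in the physical distance, uniform in the spacing,
the volume and the field within the class.  NOT Bałaban's multi-level `G_k(U)` (3.15), NOT his random-walk expansion (3.47)–(3.55), NOT analyticity in `U` (PART Ϛ treats the fine covariance only);
NOT a node discharge (N15 of record untouched); nothing continuum ∕ ℝ⁴ ∕ OS ∕ Clay.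

THE RESULTS (`M` the block torus, `L` the block side, fibre `𝕜ⁿ`, `d(x,y) = tdistT` on the fine torus, `d_M` on the block torus; `G(U) = A₀(U)⁻¹` in King's scaling `c = L²`; `ctRate` = PART Ϧ-c):
* §1 (i) SMALL CURVATURE, comb contours, `κ₀ := m² + min(a,(2(d+1))⁻¹) − (d+1)d²ε₀² > 0`: ★★★★ **`norm_blk_fullOpU_inv_le_of_small_curvature`** — for EVERY `L ≥ 2`, every volume, every unitary `U`
  with `‖P_U(x) − 1‖ ≤ ε₀∕L²` at all plaquettes: `‖blk G(U) x y‖ ≤ (2∕κ₀)·e^{−ctRate(κ₀,a,d)·d(x,y)∕L}`; `…_blocks` (`≤ (2∕κ₀)e·e^{−ctRate·d_M(B(x),B(y))}`); ★★★ `…_massless_of_small_curvature`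
  (`m² = 0`, `(d+1)d²ε₀² < min(a,(2(d+1))⁻¹)`); ★★★★ **`king_B9_thm31_shape_small_curvature`** — `∃ C δ > 0` depending on `(m², a, d, ε₀)` ONLY with `‖blk G(U) x y‖ ≤ Ce^{−δ·d(x,y)∕L}` for all
  `L ≥ 2`, `M`, `U` in the class, `x, y`.
* §2 (ii) PURE GAUGES, any tree contour system, `a > 0`, `m² ≥ 0`, every `L ≥ 1`: ★★★ **`norm_blk_fullOpU_inv_le_pureGauge`** — `‖blk G(g·1·g^*) x y‖ ≤ (2∕γ_A)·e^{−κ_A·d(x,y)∕L}` with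
  `γ_A = gamA a (d+1)`, `κ_A = kapA a (d+1)` = THE TREE's `U ≡ 1` CONSTANTS of `King1986.UniformDecay` ([Dimock2013] Lemmas 29–30), now at every pure gauge and every fibre; `norm_blk_fullOpU_inv_le_const_one`.
* §3 (iii) EVERY UNITARY `U` (no regularity), any tree contour system of depth `≤ D`, `a > 0`, `m² ≥ 0`: ★★★ **`norm_blk_fullOpU_inv_le_every_U`** — with `κ_T := m² + min(a, L²∕(L^{d+1}D)) > 0`:
  `‖blk G(U) x y‖ ≤ (2∕κ_T)e^{−ctRate(κ_T,a,d)·d(x,y)∕L}` — constants depend on `L` (honestly: `κ_T ≍ L^{1−d}∕D` at `m² = 0`) but NOT on the volume and NOT on `U`: the block term localises the massless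
  covariant propagator at EVERY link field; `…_kingComb` (`D = (d+1)(L−1)`).
* §4 (iv) SMALL-FIELD GAUGE, comb, `κ₁ := γ_A∕2 − ε₀²((d+1) + a(d+1)²) > 0`: ★★★ **`norm_blk_fullOpU_inv_le_of_small_field`** (`‖U_b − (g·1·g^*)_b‖ ≤ ε₀∕L` on all bonds ⟹ `(2∕κ₁)e^{−ctRate(κ₁,a,d)·d∕L}`, every `L ≥ 1`).
* §5 ★★★ **`king_background_propagator_decay_package`** (the four classes by name) and ★★★ **`king_B9_thm31_what_the_curved_case_adds`** (flat: tree constants at every `L`; rough: decay at every `U`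
  but `L`-dependent; small curvature: `η`-uniform — the regularity hypothesis of [B9] Thm 3.1 is exactly what upgrades (iii) to (i)).
PRIOR TREE ART (by name, not restated): Ϧ-c (`ctRate`, `ctRate_gamA`, `norm_blk_fullOpU_inv_le_king`, `norm_blk_fullOpU_inv_le_king_blocks`), Ϥ-o (`re_quadForm_fullOpU_ge_uniform_of_small_curvature`),
Ϥ-g (`re_quadForm_fullOpU_const_one_ge_gamA`, `re_quadForm_fullOpU_pureGauge_ge_gamA`, `pureGauge_mem_unitaryGroup`), Ϥ-e (`re_quadForm_fullOpU_ge_tree`, `treeGap`, `treeGap_pos`, `re_quadForm_fullOpU_kingComb_ge`),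
Ϥ-h (`re_quadForm_fullOpU_ge_uniform_of_small_field`), Ϥ-b (`kingComb`, `kingComb_depth_le`), Ͱ-a (`kingGaugeAct`), Ͻ-p (`kingPlaq`), `King1986.Torus` (`gamA`, `gamA_pos`, `kapA`).  Dedup (rg at
filing): basename 0 files; needles `norm_blk_fullOpU_inv_le_of_small_curvature|_le_pureGauge|_le_every_U|_le_of_small_field|king_B9_thm31` 0 tree files.  Locators: [Balaban1985BackgroundPropagators]
Thm 3.1 p.397–398 with (3.35)–(3.37) p.396–397 and (3.39)∕(3.46) (the statement whose one-level King-model shape is decided); [King1986] (4.33)–(4.34) p.674; [Dimock2013] App. D Lemmas 29–30.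
0 `sorry`, 0 `def`.
-/

noncomputable section
open scoped BigOperators ComplexConjugate ComplexOrder InnerProductSpace Matrix.Norms.L2Operator
open Finset Matrix WithLp

namespace Summit.QuantumFields.YangMills.BalabanUVNodes.N15KingModelRung.CombesThomas

open Literature.MathematicalPhysics.QuantumFieldTheory.LatticeDiamagneticInequality (blk)
open Literature.MathematicalPhysics.QuantumFieldTheory.Balaban1983to89.B5Prop11Plancherel (Tor fine unitVec)
open Literature.MathematicalPhysics.QuantumFieldTheory.King1986.Torus (site blockOf tdistT gamA gamA_pos kapA)
open Summit.QuantumFields.YangMills.BalabanUVNodes.N15KingModelRung.Covariant (kingGaugeAct fib)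
open Summit.QuantumFields.YangMills.BalabanUVNodes.N15KingModelRung.Cover (kingPlaq)
open Summit.QuantumFields.YangMills.BalabanUVNodes.N15KingModelRung.CovariantBlock
  (BlockTree kingComb kingComb_depth_le covQ fullOpU treeGap treeGap_pos re_quadForm_fullOpU_ge_tree re_quadForm_fullOpU_kingComb_ge
    re_quadForm_fullOpU_ge_uniform_of_small_curvature re_quadForm_fullOpU_const_one_ge_gamA re_quadForm_fullOpU_pureGauge_ge_gamA pureGauge_mem_unitaryGroup
    re_quadForm_fullOpU_ge_uniform_of_small_field)

variable {d : ℕ} {L : ℕ} [NeZero L] (M : Fin (d + 1) → ℕ) [hM : ∀ μ, NeZero (M μ)]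
variable {𝕜 : Type*} [RCLike 𝕜] {n : Type*} [Fintype n] [DecidableEq n]

/-! ## §1 (i) The small-curvature class: `η`-uniform decay — the shape of [B9] Theorem 3.1 in King's one-level model -/

section SmallCurvature

/-- ★★★★ **SMALL CURVATURE ⟹ `η`-UNIFORM EXPONENTIAL DECAY OF THE FULL BACKGROUND PROPAGATOR**: comb contours, King's scaling, `κ₀ := m² + min(a,(2(d+1))⁻¹) − (d+1)d²ε₀² > 0`; for EVERY
`L ≥ 2`, every volume `M`, every fibre, every unitary `U` with `‖P_U(x;κ,ρ) − 1‖ ≤ ε₀∕L²` at all plaquettes:  `‖blk G(U) x y‖ ≤ (2∕κ₀)·e^{−ctRate(κ₀,a,d)·d(x,y)∕L}`.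
[cite: Balaban1985BackgroundPropagators, Thm 3.1 p.397, (3.35) p.396, (3.39) p.397; King1986, (4.33) p.674; Dimock2013, App. D, Lemma 30] -/
theorem norm_blk_fullOpU_inv_le_of_small_curvature (hL : 2 ≤ L) {a : ℝ} (ha : 0 ≤ a) (m2 : ℝ) {U : Tor (fine L M) × Fin (d + 1) → Matrix n n 𝕜} (hU : ∀ bd, U bd ∈ Matrix.unitaryGroup n 𝕜)
    {ε₀ : ℝ} (hε : ∀ (x : Tor (fine L M)) (κ ρ : Fin (d + 1)), ‖kingPlaq (fine L M) U x κ ρ - 1‖ ≤ ε₀ / (L : ℝ) ^ 2)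
    (hκ₀ : 0 < m2 + min a (1 / (2 * ((d : ℝ) + 1))) - ((d : ℝ) + 1) * (d : ℝ) ^ 2 * ε₀ ^ 2) (x y : Tor (fine L M)) :
    ‖blk (fullOpU (kingComb d L) M a ((L : ℝ) ^ 2) m2 U)⁻¹ x y‖
      ≤ 2 / (m2 + min a (1 / (2 * ((d : ℝ) + 1))) - ((d : ℝ) + 1) * (d : ℝ) ^ 2 * ε₀ ^ 2)
        * Real.exp (-(ctRate (m2 + min a (1 / (2 * ((d : ℝ) + 1))) - ((d : ℝ) + 1) * (d : ℝ) ^ 2 * ε₀ ^ 2) a d / L * tdistT (fine L M) x y)) :=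
  norm_blk_fullOpU_inv_le_king (kingComb d L) M ha m2 hU hκ₀ (re_quadForm_fullOpU_ge_uniform_of_small_curvature M hL a m2 hU hε) (by omega) x y

/-- ★★★ The same in BLOCK CURRENCY: `‖blk G(U) x y‖ ≤ (2∕κ₀)·e·e^{−ctRate·d_M(B(x),B(y))}` — one factor `e^{−ctRate}` per block of separation, all `L ≥ 2`.
[cite: Balaban1985BackgroundPropagators, Thm 3.1 p.397, (3.39) p.397; King1986, (4.34) p.674] -/
theorem norm_blk_fullOpU_inv_le_of_small_curvature_blocks (hL : 2 ≤ L) {a : ℝ} (ha : 0 ≤ a) (m2 : ℝ) {U : Tor (fine L M) × Fin (d + 1) → Matrix n n 𝕜} (hU : ∀ bd, U bd ∈ Matrix.unitaryGroup n 𝕜)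
    {ε₀ : ℝ} (hε : ∀ (x : Tor (fine L M)) (κ ρ : Fin (d + 1)), ‖kingPlaq (fine L M) U x κ ρ - 1‖ ≤ ε₀ / (L : ℝ) ^ 2)
    (hκ₀ : 0 < m2 + min a (1 / (2 * ((d : ℝ) + 1))) - ((d : ℝ) + 1) * (d : ℝ) ^ 2 * ε₀ ^ 2) (x y : Tor (fine L M)) :
    ‖blk (fullOpU (kingComb d L) M a ((L : ℝ) ^ 2) m2 U)⁻¹ x y‖
      ≤ 2 / (m2 + min a (1 / (2 * ((d : ℝ) + 1))) - ((d : ℝ) + 1) * (d : ℝ) ^ 2 * ε₀ ^ 2) * Real.exp 1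
        * Real.exp (-(ctRate (m2 + min a (1 / (2 * ((d : ℝ) + 1))) - ((d : ℝ) + 1) * (d : ℝ) ^ 2 * ε₀ ^ 2) a d * tdistT M (blockOf L M x) (blockOf L M y))) :=
  norm_blk_fullOpU_inv_le_king_blocks (kingComb d L) M ha m2 hU hκ₀ (re_quadForm_fullOpU_ge_uniform_of_small_curvature M hL a m2 hU hε) (by omega) x y

/-- ★★★ **THE MASSLESS CASE** (`m² = 0`): under `(d+1)d²ε₀² < min(a,(2(d+1))⁻¹)` the massless full propagator `(L²(−Δ_U) + aQ(U)^*Q(U))⁻¹` decays exponentially, `η`-uniformly, at every small-curvature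
field — the block term is the only mass. [cite: Balaban1985BackgroundPropagators, Thm 3.1 p.397, (3.27) p.395; King1986, (2.13) p.653, (4.33) p.674] -/
theorem norm_blk_fullOpU_inv_le_massless_of_small_curvature (hL : 2 ≤ L) {a : ℝ} (ha : 0 ≤ a) {U : Tor (fine L M) × Fin (d + 1) → Matrix n n 𝕜} (hU : ∀ bd, U bd ∈ Matrix.unitaryGroup n 𝕜)
    {ε₀ : ℝ} (hε : ∀ (x : Tor (fine L M)) (κ ρ : Fin (d + 1)), ‖kingPlaq (fine L M) U x κ ρ - 1‖ ≤ ε₀ / (L : ℝ) ^ 2)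
    (hsmall : ((d : ℝ) + 1) * (d : ℝ) ^ 2 * ε₀ ^ 2 < min a (1 / (2 * ((d : ℝ) + 1)))) (x y : Tor (fine L M)) :
    ‖blk (fullOpU (kingComb d L) M a ((L : ℝ) ^ 2) 0 U)⁻¹ x y‖
      ≤ 2 / (min a (1 / (2 * ((d : ℝ) + 1))) - ((d : ℝ) + 1) * (d : ℝ) ^ 2 * ε₀ ^ 2)
        * Real.exp (-(ctRate (min a (1 / (2 * ((d : ℝ) + 1))) - ((d : ℝ) + 1) * (d : ℝ) ^ 2 * ε₀ ^ 2) a d / L * tdistT (fine L M) x y)) := by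
  have h := norm_blk_fullOpU_inv_le_of_small_curvature M hL ha 0 hU hε (by rw [zero_add]; exact sub_pos.mpr hsmall) x y
  rwa [zero_add] at h

/-- ★★★★ **THE SHAPE OF [B9] THEOREM 3.1, DECIDED IN KING's ONE-LEVEL MODEL**: given `m², a ≥ 0, d, ε₀` with `κ₀ = m² + min(a,(2(d+1))⁻¹) − (d+1)d²ε₀² > 0` there are constants `C, δ > 0`
DEPENDING ON THESE ONLY such that for every block side `L ≥ 2`, every volume, every unitary link field with plaquettes `‖P_U − 1‖ ≤ ε₀∕L²` and all sites:
`‖blk (L²(−Δ_U) + m² + aQ(U)^*Q(U))⁻¹ x y‖ ≤ C·e^{−δ·d(x,y)∕L}` — exponential decay in the physical distance, uniformly in the spacing, the volume and the field within the class.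
[cite: Balaban1985BackgroundPropagators, Thm 3.1 p.397, (3.35) p.396, (3.39) p.397, (3.46) p.398; King1986, (4.33) p.674] -/
theorem king_B9_thm31_shape_small_curvature {a : ℝ} (ha : 0 ≤ a) (m2 : ℝ) {ε₀ : ℝ} (hκ₀ : 0 < m2 + min a (1 / (2 * ((d : ℝ) + 1))) - ((d : ℝ) + 1) * (d : ℝ) ^ 2 * ε₀ ^ 2) :
    ∃ C δ : ℝ, 0 < C ∧ 0 < δ ∧ ∀ (L : ℕ) [NeZero L], 2 ≤ L → ∀ (U : Tor (fine L M) × Fin (d + 1) → Matrix n n 𝕜), (∀ bd, U bd ∈ Matrix.unitaryGroup n 𝕜) →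
      (∀ (x : Tor (fine L M)) (κ ρ : Fin (d + 1)), ‖kingPlaq (fine L M) U x κ ρ - 1‖ ≤ ε₀ / (L : ℝ) ^ 2) →
        ∀ x y : Tor (fine L M), ‖blk (fullOpU (kingComb d L) M a ((L : ℝ) ^ 2) m2 U)⁻¹ x y‖ ≤ C * Real.exp (-(δ / L * tdistT (fine L M) x y)) :=
  ⟨2 / (m2 + min a (1 / (2 * ((d : ℝ) + 1))) - ((d : ℝ) + 1) * (d : ℝ) ^ 2 * ε₀ ^ 2), ctRate (m2 + min a (1 / (2 * ((d : ℝ) + 1))) - ((d : ℝ) + 1) * (d : ℝ) ^ 2 * ε₀ ^ 2) a d,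
    by positivity, ctRate_pos hκ₀ ha d, fun L _ hL U hU hε x y => norm_blk_fullOpU_inv_le_of_small_curvature M hL ha m2 hU hε hκ₀ x y⟩

end SmallCurvature

/-! ## §2 (ii) Pure gauges: the tree's `U ≡ 1` constants at every flat field -/

section PureGauge

variable (T : BlockTree d L)

/-- ★★★ **AT EVERY PURE GAUGE THE FULL PROPAGATOR DECAYS WITH THE TREE's `U ≡ 1` CONSTANTS**: for `a > 0`, `m² ≥ 0`, every `L ≥ 1`, every volume, every tree contour system, every unitary gauge
`g` (any fibre): `‖blk G(g·1·g^*) x y‖ ≤ (2∕γ_A)·e^{−κ_A·d(x,y)∕L}`, `γ_A = gamA a (d+1)`, `κ_A = kapA a (d+1)` ([Dimock2013] Lemmas 29–30 in King's normalisation, `King1986.UniformDecay`).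
[cite: Dimock2013, App. D, Lemmas 29–30; King1986, (4.33) p.674; Balaban1985BackgroundPropagators, (3.34) p.396] -/
theorem norm_blk_fullOpU_inv_le_pureGauge (hL : 1 ≤ L) {a m2 : ℝ} (ha : 0 < a) (hm : 0 ≤ m2) {g : Tor (fine L M) → Matrix n n 𝕜} (hg : ∀ x, g x ∈ Matrix.unitaryGroup n 𝕜)
    (x y : Tor (fine L M)) :
    ‖blk (fullOpU T M a ((L : ℝ) ^ 2) m2 (kingGaugeAct (fine L M) g fun _ => (1 : Matrix n n 𝕜)))⁻¹ x y‖
      ≤ 2 / gamA a (d + 1) * Real.exp (-(kapA a (d + 1) / L * tdistT (fine L M) x y)) := by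
  rw [← ctRate_gamA]
  exact norm_blk_fullOpU_inv_le_king T M ha.le m2 (pureGauge_mem_unitaryGroup (L := L) M hg) (gamA_pos ha (d + 1))
    (re_quadForm_fullOpU_pureGauge_ge_gamA T M hL ha.le hm hg) hL x y

/-- ★★ AT `U ≡ 1` (King's own `A₀ ⊗ 1`): `‖blk G(1) x y‖ ≤ (2∕γ_A)e^{−κ_A·d(x,y)∕L}`, every `L ≥ 1`, every fibre. [cite: King1986, (4.33) p.674; Dimock2013, App. D, Lemma 30] -/
theorem norm_blk_fullOpU_inv_le_const_one (hL : 1 ≤ L) {a m2 : ℝ} (ha : 0 < a) (hm : 0 ≤ m2) (x y : Tor (fine L M)) :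
    ‖blk (fullOpU T M a ((L : ℝ) ^ 2) m2 (fun _ => (1 : Matrix n n 𝕜)))⁻¹ x y‖ ≤ 2 / gamA a (d + 1) * Real.exp (-(kapA a (d + 1) / L * tdistT (fine L M) x y)) := by
  rw [← ctRate_gamA]
  exact norm_blk_fullOpU_inv_le_king T M ha.le m2 (fun _ => Submonoid.one_mem _) (gamA_pos ha (d + 1)) (re_quadForm_fullOpU_const_one_ge_gamA T M hL ha.le hm) hL x y

end PureGauge

/-! ## §3 (iii) Every unitary link field: volume-free, `U`-free, `L`-dependent decay -/

section EveryU

variable (T : BlockTree d L)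

/-- ★★★ **THE BLOCK TERM LOCALISES THE COVARIANT PROPAGATOR AT EVERY LINK FIELD**: for every tree contour system of depth `≤ D` (`D > 0`), `a > 0`, `m² ≥ 0`, every `L ≥ 1`, every volume, every
fibre and EVERY unitary `U` (no regularity): with `κ_T := m² + min(a, L²∕(L^{d+1}D))`,  `‖blk G(U) x y‖ ≤ (2∕κ_T)·e^{−ctRate(κ_T,a,d)·d(x,y)∕L}` — constants independent of the volume and of `U`
(they depend on `L`; PART Ϥ-f's rough witness shows that some `L`-dependence is unavoidable without regularity). [cite: Balaban1985BackgroundPropagators, p.395 l.1–3, (3.27) p.395; King1986, (2.13) p.653] -/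
theorem norm_blk_fullOpU_inv_le_every_U {D : ℕ} (hD : ∀ j, T.depth j ≤ D) (hD0 : 0 < D) (hL : 1 ≤ L) {a m2 : ℝ} (ha : 0 < a) (hm : 0 ≤ m2)
    {U : Tor (fine L M) × Fin (d + 1) → Matrix n n 𝕜} (hU : ∀ bd, U bd ∈ Matrix.unitaryGroup n 𝕜) (x y : Tor (fine L M)) :
    ‖blk (fullOpU T M a ((L : ℝ) ^ 2) m2 U)⁻¹ x y‖
      ≤ 2 / (m2 + treeGap a ((L : ℝ) ^ 2) L d D) * Real.exp (-(ctRate (m2 + treeGap a ((L : ℝ) ^ 2) L d D) a d / L * tdistT (fine L M) x y)) := by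
  have hL0 : (0 : ℝ) < L := by exact_mod_cast hL
  have hκ : 0 < m2 + treeGap a ((L : ℝ) ^ 2) L d D := by have := treeGap_pos (L := L) ha (by positivity : (0 : ℝ) < (L : ℝ) ^ 2) hD0 d; linarith
  exact norm_blk_fullOpU_inv_le_king T M ha.le m2 hU hκ (re_quadForm_fullOpU_ge_tree T M hD (by positivity) a m2 hU) hL x y

omit T in
/-- ★★★ The same with the COMB (`D = (d+1)(L−1)`, `L ≥ 2`): every unitary `U` on every volume. [cite: Balaban1985BackgroundPropagators, p.395 l.1–3; Balaban1984PropagatorsI, (1.7) p.18] -/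
theorem norm_blk_fullOpU_inv_le_every_U_kingComb (hL : 2 ≤ L) {a m2 : ℝ} (ha : 0 < a) (hm : 0 ≤ m2)
    {U : Tor (fine L M) × Fin (d + 1) → Matrix n n 𝕜} (hU : ∀ bd, U bd ∈ Matrix.unitaryGroup n 𝕜) (x y : Tor (fine L M)) :
    ‖blk (fullOpU (kingComb d L) M a ((L : ℝ) ^ 2) m2 U)⁻¹ x y‖
      ≤ 2 / (m2 + treeGap a ((L : ℝ) ^ 2) L d ((d + 1) * (L - 1)))
        * Real.exp (-(ctRate (m2 + treeGap a ((L : ℝ) ^ 2) L d ((d + 1) * (L - 1))) a d / L * tdistT (fine L M) x y)) :=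
  norm_blk_fullOpU_inv_le_every_U M (kingComb d L) kingComb_depth_le (Nat.mul_pos (Nat.succ_pos d) (by omega)) (by omega) ha hm hU x y

end EveryU

/-! ## §4 (iv) Small-field gauges -/

section SmallField

/-- ★★★ **SMALL-FIELD GAUGE ⟹ `η`-UNIFORM DECAY**: comb contours, `a, m² ≥ 0`, `κ₁ := γ_A∕2 − ε₀²((d+1) + a(d+1)²) > 0`; for every `L ≥ 1`, every volume, every unitary `U` within `ε₀∕L` (bondwise,
operator norm) of a pure gauge `g·1·g^*`:  `‖blk G(U) x y‖ ≤ (2∕κ₁)·e^{−ctRate(κ₁,a,d)·d(x,y)∕L}`. [cite: Balaban1985BackgroundPropagators, (3.37) p.396, Thm 3.1 p.397; King1986, (4.33) p.674] -/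
theorem norm_blk_fullOpU_inv_le_of_small_field (hL : 1 ≤ L) {a m2 : ℝ} (ha : 0 ≤ a) (hm : 0 ≤ m2)
    {U : Tor (fine L M) × Fin (d + 1) → Matrix n n 𝕜} (hU : ∀ bd, U bd ∈ Matrix.unitaryGroup n 𝕜) {g : Tor (fine L M) → Matrix n n 𝕜} (hg : ∀ x, g x ∈ Matrix.unitaryGroup n 𝕜)
    {ε₀ : ℝ} (hnear : ∀ bd, ‖U bd - kingGaugeAct (fine L M) g (fun _ => (1 : Matrix n n 𝕜)) bd‖ ≤ ε₀ / L)
    (hκ₁ : 0 < gamA a (d + 1) / 2 - ε₀ ^ 2 * (((d : ℝ) + 1) + a * ((d : ℝ) + 1) ^ 2)) (x y : Tor (fine L M)) :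
    ‖blk (fullOpU (kingComb d L) M a ((L : ℝ) ^ 2) m2 U)⁻¹ x y‖
      ≤ 2 / (gamA a (d + 1) / 2 - ε₀ ^ 2 * (((d : ℝ) + 1) + a * ((d : ℝ) + 1) ^ 2))
        * Real.exp (-(ctRate (gamA a (d + 1) / 2 - ε₀ ^ 2 * (((d : ℝ) + 1) + a * ((d : ℝ) + 1) ^ 2)) a d / L * tdistT (fine L M) x y)) :=
  norm_blk_fullOpU_inv_le_king (kingComb d L) M ha m2 hU hκ₁ (re_quadForm_fullOpU_ge_uniform_of_small_field M hL ha hm hU hg hnear) hL x y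

end SmallField

/-! ## §5 Packages -/

section Package

/-- ★★★ **THE DECAY PACKAGE OF KING's ∕ BAŁABAN's ONE-LEVEL BACKGROUND PROPAGATOR** (comb contours, King's scaling, `a > 0`, `m² ≥ 0`), BY NAME: (1) at `U ≡ 1` and (2) at every pure gauge, the tree's
constants `(2∕γ_A, κ_A)` for every `L ≥ 1`; (3) at EVERY unitary `U`, decay with volume-free, `U`-free, `L`-dependent constants (`L ≥ 2`); (4) on the small-curvature class `‖P_U − 1‖ ≤ ε₀∕L²`
with `κ₀ > 0`, `η`-uniform decay `(2∕κ₀)e^{−ctRate(κ₀)d∕L}` for every `L ≥ 2`. [cite: Balaban1985BackgroundPropagators, Thm 3.1 p.397; King1986, (4.33) p.674; Dimock2013, App. D, Lemmas 29–30] -/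
theorem king_background_propagator_decay_package (hL : 2 ≤ L) {a m2 : ℝ} (ha : 0 < a) (hm : 0 ≤ m2) {ε₀ : ℝ}
    (hκ₀ : 0 < m2 + min a (1 / (2 * ((d : ℝ) + 1))) - ((d : ℝ) + 1) * (d : ℝ) ^ 2 * ε₀ ^ 2) :
    (∀ x y : Tor (fine L M), ‖blk (fullOpU (kingComb d L) M a ((L : ℝ) ^ 2) m2 (fun _ => (1 : Matrix n n 𝕜)))⁻¹ x y‖
        ≤ 2 / gamA a (d + 1) * Real.exp (-(kapA a (d + 1) / L * tdistT (fine L M) x y)))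
      ∧ (∀ (g : Tor (fine L M) → Matrix n n 𝕜), (∀ x, g x ∈ Matrix.unitaryGroup n 𝕜) → ∀ x y : Tor (fine L M),
          ‖blk (fullOpU (kingComb d L) M a ((L : ℝ) ^ 2) m2 (kingGaugeAct (fine L M) g fun _ => (1 : Matrix n n 𝕜)))⁻¹ x y‖
            ≤ 2 / gamA a (d + 1) * Real.exp (-(kapA a (d + 1) / L * tdistT (fine L M) x y)))
      ∧ (∀ (U : Tor (fine L M) × Fin (d + 1) → Matrix n n 𝕜), (∀ bd, U bd ∈ Matrix.unitaryGroup n 𝕜) → ∀ x y : Tor (fine L M),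
          ‖blk (fullOpU (kingComb d L) M a ((L : ℝ) ^ 2) m2 U)⁻¹ x y‖
            ≤ 2 / (m2 + treeGap a ((L : ℝ) ^ 2) L d ((d + 1) * (L - 1)))
              * Real.exp (-(ctRate (m2 + treeGap a ((L : ℝ) ^ 2) L d ((d + 1) * (L - 1))) a d / L * tdistT (fine L M) x y)))
      ∧ (∀ (U : Tor (fine L M) × Fin (d + 1) → Matrix n n 𝕜), (∀ bd, U bd ∈ Matrix.unitaryGroup n 𝕜) →
          (∀ (x : Tor (fine L M)) (κ ρ : Fin (d + 1)), ‖kingPlaq (fine L M) U x κ ρ - 1‖ ≤ ε₀ / (L : ℝ) ^ 2) → ∀ x y : Tor (fine L M),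
          ‖blk (fullOpU (kingComb d L) M a ((L : ℝ) ^ 2) m2 U)⁻¹ x y‖
            ≤ 2 / (m2 + min a (1 / (2 * ((d : ℝ) + 1))) - ((d : ℝ) + 1) * (d : ℝ) ^ 2 * ε₀ ^ 2)
              * Real.exp (-(ctRate (m2 + min a (1 / (2 * ((d : ℝ) + 1))) - ((d : ℝ) + 1) * (d : ℝ) ^ 2 * ε₀ ^ 2) a d / L * tdistT (fine L M) x y))) :=
  ⟨fun x y => norm_blk_fullOpU_inv_le_const_one M (kingComb d L) (by omega) ha hm x y,
    fun g hg x y => norm_blk_fullOpU_inv_le_pureGauge M (kingComb d L) (by omega) ha hm hg x y,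
    fun U hU x y => norm_blk_fullOpU_inv_le_every_U_kingComb M hL ha hm hU x y,
    fun U hU hε x y => norm_blk_fullOpU_inv_le_of_small_curvature M hL ha.le m2 hU hε hκ₀ x y⟩

/-- ★★★ **WHAT THE CURVED CASE ADDS FOR THE BACKGROUND PROPAGATOR, BY NAME** (massless, `a > 0`, comb, `L ≥ 2`): (a) FLAT (every pure gauge): `η`-uniform decay with the tree's `U ≡ 1` constants
`(2∕γ_A, κ_A)`; (b) ROUGH (every unitary `U`): the massless full propagator still EXISTS and DECAYS on every volume, but with the `L`-dependent tree-gauge floor `min(a, L²∕(L^{d+1}(d+1)(L−1)))`;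
(c) SMALL CURVATURE `‖P_U − 1‖ ≤ ε₀∕L²` with `(d+1)d²ε₀² < min(a,(2(d+1))⁻¹)`: `η`-UNIFORM decay again, `(2∕κ₀)e^{−ctRate(κ₀)d∕L}` — the regularity hypothesis of [B9] Theorem 3.1 is exactly what upgrades
(b) to (c). [cite: Balaban1985BackgroundPropagators, Thm 3.1 p.397, (3.35) p.396, p.395 l.1–3; King1986, (4.33) p.674; Dimock2013, App. D, Lemma 30] -/
theorem king_B9_thm31_what_the_curved_case_adds (hL : 2 ≤ L) {a : ℝ} (ha : 0 < a) {ε₀ : ℝ} (hsmall : ((d : ℝ) + 1) * (d : ℝ) ^ 2 * ε₀ ^ 2 < min a (1 / (2 * ((d : ℝ) + 1)))) :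
    (∀ (g : Tor (fine L M) → Matrix n n 𝕜), (∀ x, g x ∈ Matrix.unitaryGroup n 𝕜) → ∀ x y : Tor (fine L M),
          ‖blk (fullOpU (kingComb d L) M a ((L : ℝ) ^ 2) 0 (kingGaugeAct (fine L M) g fun _ => (1 : Matrix n n 𝕜)))⁻¹ x y‖
            ≤ 2 / gamA a (d + 1) * Real.exp (-(kapA a (d + 1) / L * tdistT (fine L M) x y)))
      ∧ (∀ (U : Tor (fine L M) × Fin (d + 1) → Matrix n n 𝕜), (∀ bd, U bd ∈ Matrix.unitaryGroup n 𝕜) → ∀ x y : Tor (fine L M),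
          ‖blk (fullOpU (kingComb d L) M a ((L : ℝ) ^ 2) 0 U)⁻¹ x y‖
            ≤ 2 / (0 + treeGap a ((L : ℝ) ^ 2) L d ((d + 1) * (L - 1)))
              * Real.exp (-(ctRate (0 + treeGap a ((L : ℝ) ^ 2) L d ((d + 1) * (L - 1))) a d / L * tdistT (fine L M) x y)))
      ∧ (∀ (U : Tor (fine L M) × Fin (d + 1) → Matrix n n 𝕜), (∀ bd, U bd ∈ Matrix.unitaryGroup n 𝕜) →
          (∀ (x : Tor (fine L M)) (κ ρ : Fin (d + 1)), ‖kingPlaq (fine L M) U x κ ρ - 1‖ ≤ ε₀ / (L : ℝ) ^ 2) → ∀ x y : Tor (fine L M),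
          ‖blk (fullOpU (kingComb d L) M a ((L : ℝ) ^ 2) 0 U)⁻¹ x y‖
            ≤ 2 / (min a (1 / (2 * ((d : ℝ) + 1))) - ((d : ℝ) + 1) * (d : ℝ) ^ 2 * ε₀ ^ 2)
              * Real.exp (-(ctRate (min a (1 / (2 * ((d : ℝ) + 1))) - ((d : ℝ) + 1) * (d : ℝ) ^ 2 * ε₀ ^ 2) a d / L * tdistT (fine L M) x y))) :=
  ⟨fun g hg x y => norm_blk_fullOpU_inv_le_pureGauge M (kingComb d L) (by omega) ha le_rfl hg x y,
    fun U hU x y => norm_blk_fullOpU_inv_le_every_U_kingComb M hL ha le_rfl hU x y,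
    fun U hU hε x y => norm_blk_fullOpU_inv_le_massless_of_small_curvature M hL ha.le hU hε hsmall x y⟩

end Package

end Summit.QuantumFields.YangMills.BalabanUVNodes.N15KingModelRung.CombesThomas

end
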